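import Mathlib
import Summits.Ventures.PercRepro2.TwoHullMasterPath
import Summits.Ventures.PercRepro2.TwoHullMasterGlue

/-!
# (MM) on every graph in which `l` and `h` are joined by a path of cut vertices (blind cell
PercRepro2, night-4 g39, 2026-08-29; proofs/NIGHT4-G39.md §7, Theorem 1)

Glue an ARBITRARY graph `G_h` to the path `p 0 – ⋯ – p k` at `h = p k` and an arbitrary graph
`G_l` at `l = p 0` (the inner vertices of the path keep degree 2: the gluings meet the path only
at its ends).  Then (MM) holds for `(G; l, h)`: **`twoHullMaster_path_glue`** — the path theorem
`twoHullMaster_path` followed by the two cut-vertex reductions `twoHullMaster_glue_h` /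
`twoHullMaster_glue_l`.  No hypothesis on `G_l`, `G_h`: the one-dimensional interface between the
two hulls kills every interaction.
-/

namespace Summit.Ventures.PercRepro2

namespace Path2

open Hull LocRows Glue

open scoped Classical

variable {V : Type*} {k : ℕ} {E₁ E₃ : Type*} [Fintype E₁] [Fintype E₃] [DecidableEq E₁]
  [DecidableEq E₃]

/-- **(MM) on `G_l ∪_l (P ∪_h G_h)`**: the path `p` glued to `G_h` (`ends₃`) at `p k` and the result
glued to `G_l` (`ends₁`) at `p 0`. -/
theorem twoHullMaster_path_glue {p : Fin (k + 1) → V} (hp : Function.Injective p) (hk : 0 < k)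
    {ends₁ : E₁ → Sym2 V} {ends₃ : E₃ → Sym2 V} {VP V₁ V₃ : Set V}
    (hg₃ : IsGluing (pathEnds p) ends₃ (p (Fin.last k)) VP V₃) (hl₃ : p 0 ∈ VP)
    (hg₁ : IsGluing (Glue.glue (pathEnds p) ends₃) ends₁ (p 0) (VP ∪ V₃) V₁) :
    TwoHullMaster (Glue.glue (Glue.glue (pathEnds p) ends₃) ends₁) (p 0) (p (Fin.last k)) := by
  have hne : p 0 ≠ p (Fin.last k) := by
    intro h'
    have := hp h'
    rw [Fin.ext_iff, Fin.val_zero, Fin.val_last] at this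
    omega
  have h1 : TwoHullMaster (Glue.glue (pathEnds p) ends₃) (p 0) (p (Fin.last k)) :=
    twoHullMaster_glue_h hg₃ hl₃ hne (twoHullMaster_path hp)
  exact twoHullMaster_glue_l hg₁ (Or.inl hg₃.c_mem₁) hne.symm h1

end Path2

end Summit.Ventures.PercRepro2
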